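import Mathlib.Analysis.SpecialFunctions.Log.PosLog
import Mathlib.Analysis.Normed.Group.Bounded
import Mathlib.NumberTheory.Height.NumberField
import Literature.IUT.LogVolume.Corollary22Statement
import HarnessLib

/-!
# [IUTchIV] Corollary 2.2 (i): `(1/6)·log(q^∀(−)) ≈ (1/6)·ht_∞` on `K_V` — PROVED

Mochizuki, *Inter-universal Teichmüller theory IV*, RIMS manuscript (Apr. 2020; = PRIMS **57** (2021)),
Cor. 2.2 (i), p. 41, middle equivalence; printed proof (p. 43): "since the support of `K_V` contains the
unique archimedean prime of `ℚ`, it follows immediately from the various definitions involved … that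
`log(q^∀(−)) ≈ ht_∞` on `K_V ⊆ U_X(ℚ̄)` [cf. the argument of the final paragraph of the proof of [GenEll],
Lemma 3.7]". Classical height bookkeeping; TAKES NO SIDE on anything disputed.

With the representatives of `Corollary22Statement.lean` (`logQForall P` = normalized degree of the pole
divisor of `j(λ)`; `htInfty P = (1/[F:ℚ])·h_F(j(λ))`, Mathlib's logarithmic Weil height) the argument is:
by `NumberField.logHeight₁_eq`, `h_F(j) = Σ_{w ∣ ∞} m_w·log⁺|j|_w + Σ_{v ∤ ∞} log⁺|j|_v`; the finite part
is EXACTLY `[F:ℚ]·log(q^∀)` (`finsum_posLog_finitePlace`: `log⁺(N(v)^{−ord_v j}) = max(0, −ord_v j)·log N(v)`),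
and the archimedean part is `≥ 0` and `≤ [F:ℚ]·log⁺ C_K` on `K_V`, where `C_K := max_{K_∞} |j|` exists because
`K_∞` is a compact subset of `ℂ ∖ {0, 1}` on which `j` is continuous (`sum_infinitePlace_le`). Hence
`log(q^∀) ≤ ht_∞ ≤ log(q^∀) + log⁺ C_K` on `K_V` (`logQForall_le_htInfty`, `htInfty_le`), i.e. the BD-equivalence
`partI_middle`. (The other two equivalences of (i) — `log(q^{∤2}) ≈ log(q^∀)` from (∗^{j-inv}), and
`(1/6)·ht_∞ ≈ ht_{ω_X(D)}`, the functoriality of heights under the degree-6 map `j` — are not proved here.)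
-/

noncomputable section

namespace Literature.IUT.LogVolume

namespace Cor22

open NumberField IsDedekindDomain Real Literature.NumberTheory.DiophantineGeometry.GenEll

/-- `j` commutes with field homomorphisms: `σ(j(λ)) = j(σ(λ))`. [claim: Mochizuki2012, status: disputed] -/
theorem map_jInv {F L : Type*} [Field F] [Field L] (σ : F →+* L) (x : F) : σ (jInv x) = jInv (σ x) := by
  simp [jInv, map_div₀, map_ofNat]

/-! ## The finite part of `h_F(j(λ))` is `[F:ℚ]·log(q^∀(λ))` -/

/-- For `N > 1` and `k ∈ ℤ`: `log⁺(N^k) = max(0, k)·log N`. [folklore] -/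
private theorem posLog_zpow_eq {N : ℝ} (hN : 1 < N) (k : ℤ) :
    log⁺ (N ^ k) = ((max k 0 : ℤ) : ℝ) * Real.log N := by
  have hN0 : 0 < N := by linarith
  rw [Real.posLog_eq_log_max_one (zpow_nonneg hN0.le k)]
  rcases le_or_gt 0 k with hk | hk
  · rw [max_eq_right (one_le_zpow₀ hN.le hk), Real.log_zpow, max_eq_left hk]
  · rw [max_eq_left (zpow_le_one_of_nonpos₀ hN.le hk.le), Real.log_one, max_eq_right hk.le]
    simp

/-- At a finite place: `log⁺‖j(λ)‖_v = h_v·log N(v)` with `h_v = max(0, −ord_v j(λ))` the local height.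
[claim: Mochizuki2012, status: disputed] -/
theorem posLog_adicAbv_jInv (P : NFPoint) (v : HeightOneSpectrum (𝓞 P.F)) :
    log⁺ (NumberField.HeightOneSpectrum.adicAbv P.F v (jInv P.x)) = localHeight P v * logNorm P.F v := by
  unfold localHeight
  by_cases hj : jInv P.x = 0
  · rw [hj, map_zero, Real.posLog_def]
    simp [ord_zero]
  · rw [adicAbv_eq_absNorm_zpow P.F v hj,
      posLog_zpow_eq (by exact_mod_cast NumberField.HeightOneSpectrum.one_lt_absNorm v), logNorm]
    congr 1
    rw [← Int.toNat_eq_max]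
    exact Int.cast_natCast _

/-- Off the bad places the local height vanishes. [claim: Mochizuki2012, status: disputed] -/
theorem localHeight_eq_zero_of_not_mem {P : NFPoint} {v : HeightOneSpectrum (𝓞 P.F)}
    (hv : v ∉ badPlaces P) : localHeight P v = 0 := by
  unfold badPlaces at hv
  rw [Set.Finite.mem_toFinset] at hv
  unfold HeightOneSpectrum.Support at hv
  simp only [Set.mem_setOf_eq, not_lt] at hv
  -- `valuation ≤ 1` means `log(valuation) ≤ 0`, i.e. `ord_v(j) = −log ≥ 0`, so `(−ord).toNat = 0`
  have hlog : WithZero.log (v.valuation P.F (jInv P.x)) ≤ 0 := by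
    by_cases h0 : v.valuation P.F (jInv P.x) = 0
    · rw [h0]; simp
    · exact (WithZero.log_le_iff_le_exp h0).mpr (by rwa [WithZero.exp_zero])
  unfold localHeight ord
  rw [neg_neg, Int.toNat_of_nonpos hlog]
  simp

/-- The finite part of the height of `j(λ)` is `[F:ℚ]·log(q^∀(λ))`:
`Σ_{v ∤ ∞} log⁺‖j(λ)‖_v = deĝ(Σ_v h_v·[v])`. [claim: Mochizuki2012, status: disputed] -/
theorem finsum_posLog_finitePlace (P : NFPoint) :
    (∑ᶠ w : FinitePlace P.F, log⁺ (w (jInv P.x))) = FinDivisor.deg P.F (qDivisor P ∅) := by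
  classical
  -- pass from finite places to maximal ideals
  have h1 : (∑ᶠ w : FinitePlace P.F, log⁺ (w (jInv P.x))) =
      ∑ᶠ v : HeightOneSpectrum (𝓞 P.F), localHeight P v * logNorm P.F v := by
    rw [← finsum_comp_equiv (FinitePlace.equivHeightOneSpectrum (K := P.F)).symm]
    refine finsum_congr fun v => ?_
    rw [FinitePlace.equivHeightOneSpectrum_symm_apply, FinitePlace.norm_embedding,
      posLog_adicAbv_jInv]
  rw [h1, finsum_eq_sum_of_support_subset (s := badPlaces P)]
  · unfold qDivisor
    rw [Finset.filter_true_of_mem (fun v _ => by simp), FinDivisor.deg_sum_of]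
  · intro v hv
    rw [Function.mem_support] at hv
    by_contra hnot
    exact hv (by rw [localHeight_eq_zero_of_not_mem hnot, zero_mul])

/-- `[F:ℚ]·log(q^∀) = deĝ(qDivisor)` (normalized vs plain degree). [claim: Mochizuki2012, status: disputed] -/
theorem degree_mul_logQForall (P : NFPoint) :
    (P.degree : ℝ) * logQForall P = FinDivisor.deg P.F (qDivisor P ∅) := by
  unfold logQForall logQAvoid NFPoint.degree
  rw [FinDivisor.ndeg_apply]
  have : (0 : ℝ) < Module.finrank ℚ P.F := FinDivisor.finrank_pos
  field_simp

/-! ## The archimedean part is bounded on `K_V` -/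

/-- `j` is bounded on the archimedean bounding domain `K_∞` (compact in `ℂ ∖ {0,1}`): there is `C` with
`|j(z)| ≤ C` for `z ∈ K_∞`. [claim: Mochizuki2012, status: disputed] -/
theorem exists_jInv_bound (D : CBData) : ∃ C : ℝ, ∀ z ∈ D.Karc, ‖jInv z‖ ≤ C := by
  have hcont : ContinuousOn (fun z : ℂ => jInv z) D.Karc := by
    unfold jInv
    refine ContinuousOn.div (by fun_prop) (by fun_prop) fun z hz => ?_
    have h := D.Karc_subset hz
    simp only [Set.mem_setOf_eq] at h
    have h1 : z - 1 ≠ 0 := sub_ne_zero.mpr h.2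
    exact mul_ne_zero (pow_ne_zero _ h.1) (pow_ne_zero _ h1)
  exact D.Karc_isCompact.exists_bound_of_continuousOn hcont

/-- On `K_V`: `0 ≤ Σ_{w ∣ ∞} m_w·log⁺|j(λ)|_w ≤ [F:ℚ]·log⁺ C`, since every conjugate of `λ` lies in `K_∞`.
[claim: Mochizuki2012, status: disputed] -/
theorem sum_infinitePlace_le {D : CBData} {P : NFPoint} (hP : D.Mem P) {C : ℝ}
    (hC : ∀ z ∈ D.Karc, ‖jInv z‖ ≤ C) :
    0 ≤ ∑ w : InfinitePlace P.F, (w.mult : ℝ) * log⁺ (w (jInv P.x)) ∧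
      ∑ w : InfinitePlace P.F, (w.mult : ℝ) * log⁺ (w (jInv P.x)) ≤ (P.degree : ℝ) * log⁺ C := by
  constructor
  · exact Finset.sum_nonneg fun w _ => mul_nonneg (by positivity) Real.posLog_nonneg
  · have hw : ∀ w : InfinitePlace P.F, log⁺ (w (jInv P.x)) ≤ log⁺ C := by
      intro w
      rw [← InfinitePlace.norm_embedding_eq, map_jInv]
      exact Real.posLog_le_posLog (norm_nonneg _) (hC _ (hP.1 w.embedding))
    calc ∑ w : InfinitePlace P.F, (w.mult : ℝ) * log⁺ (w (jInv P.x))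
        ≤ ∑ w : InfinitePlace P.F, (w.mult : ℝ) * log⁺ C :=
          Finset.sum_le_sum fun w _ => mul_le_mul_of_nonneg_left (hw w) (by positivity)
      _ = (P.degree : ℝ) * log⁺ C := by
          rw [← Finset.sum_mul]
          congr 1
          unfold NFPoint.degree
          rw [← InfinitePlace.sum_mult_eq (K := P.F)]
          push_cast
          rfl

/-! ## The comparison -/

/-- `log(q^∀(λ)) ≤ ht_∞(λ)` for every point (the archimedean part of the height is `≥ 0`).
[claim: Mochizuki2012, status: disputed] -/
theorem logQForall_le_htInfty (P : NFPoint) : logQForall P ≤ htInfty P := by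
  have hd : (0 : ℝ) < P.degree := by exact_mod_cast P.degree_pos
  have hfin := finsum_posLog_finitePlace P
  have hdeg := degree_mul_logQForall P
  have harch : 0 ≤ ∑ w : InfinitePlace P.F, (w.mult : ℝ) * log⁺ (w (jInv P.x)) :=
    Finset.sum_nonneg fun w _ => mul_nonneg (by positivity) Real.posLog_nonneg
  unfold htInfty
  rw [NumberField.logHeight₁_eq, hfin, ← hdeg]
  rw [le_inv_mul_iff₀ hd]
  linarith

/-- On `K_V`: `ht_∞(λ) ≤ log(q^∀(λ)) + log⁺ C`. [claim: Mochizuki2012, status: disputed] -/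
theorem htInfty_le {D : CBData} {P : NFPoint} (hP : D.Mem P) {C : ℝ}
    (hC : ∀ z ∈ D.Karc, ‖jInv z‖ ≤ C) : htInfty P ≤ logQForall P + log⁺ C := by
  have hd : (0 : ℝ) < P.degree := by exact_mod_cast P.degree_pos
  have hfin := finsum_posLog_finitePlace P
  have hdeg := degree_mul_logQForall P
  have harch := (sum_infinitePlace_le hP hC).2
  unfold htInfty
  rw [NumberField.logHeight₁_eq, hfin, ← hdeg, inv_mul_le_iff₀ hd]
  nlinarith

/-- **[IUTchIV] Cor. 2.2 (i), middle equivalence, PROVED**: `(1/6)·log(q^∀(−)) ≈ (1/6)·ht_∞` as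
BD-classes of functions on `K_V ⊆ U_X(ℚ̄)` (for the representatives of `Corollary22Statement.lean`; any
compactly bounded `K_V` — only its archimedean bounding domain is used). [claim: Mochizuki2012, status: disputed] -/
theorem partI_middle (D : CBData) :
    BDEquiv D.toSet (fun P => 1 / 6 * logQForall P) (fun P => 1 / 6 * htInfty P) := by
  obtain ⟨C, hC⟩ := exists_jInv_bound D
  rw [bdEquiv_iff_abs]
  refine ⟨1 / 6 * log⁺ C, fun P hP => ?_⟩
  have h1 := logQForall_le_htInfty P
  have h2 := htInfty_le hP hC
  rw [abs_le]
  constructor <;> linarith [Real.posLog_nonneg (x := C)]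

end Cor22

end Literature.IUT.LogVolume

end
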